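import Literature.MathematicalPhysics.KineticTheory.HardSphereGibbsGNZIdentity
import Literature.Analysis.FluidPDE.InfiniteHardSphereDynamics

/-!
# The Gibbs-mixture wall, core III: the one-body law of the marks of a hard-sphere Gibbs state is Maxwellian
# (line `FirstLemma`, crux stmt-AtomisticToContinuum-14135 `AntiMazurCoboundaries.CorrectorPressureDecay`; lead seat c9)

Third helper file of the registered stub `gibbsMixtureWall_holds : GibbsMixtureWall` (…KiferWallMacroErgodic.lean),
namespace `Summit.AtomisticToContinuum.HydrodynamicLimit.Theorems.KiferCompactification`: piece (P1) of the lead's design,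
THE MARKED CAMPBELL IDENTITY OF A HARD-SPHERE GIBBS STATE. For a DLR state `κ` of the hard-sphere gas
(`IsHardSphereGibbs ε z β u κ`, `z ≥ 0`, `β > 0`), a bounded measurable window `Λ ⊆ ℝ³` and a measurable `F ≥ 0` on
velocities,

  `E_κ[ Σ_{(q,v) ∈ ω, q ∈ Λ} F(v) ] = E_κ[ N_Λ ] · ∫ F(v) M_β(v - u) dv`      (`gmc_lintegral_windowSum_mark_eq`, MAIN),

i.e. the one-body (Campbell) measure of `κ` on `Λ × ℝ³` is `(intensity measure on Λ) ⊗ Maxwellian(β, u)`: the marks of a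
Gibbs state are Maxwellian with the parameters of the specification, whatever the (possibly non translation-invariant)
positional structure. Mechanism (no cluster expansion, every activity): by the DLR equation for functions
(`lintegral_eq_lintegral_gibbsSpecMeasure`) it suffices to prove the identity for the finite-volume specification
`γ_Λ(· | Y)`, i.e. for the weight measure `W = Σₖ (zᵏ/k!) (superposeIn Λ · Y)_* (m^{⊗k}|_{hard core})`, `m = Leb_Λ ⊗ M_{β,u}`:

* `gmc_lintegral_indicator_hardCore_mul_mark` — INTEGRATING OUT THE VELOCITY OF ONE THROWN PARTICLE: for measurable
  `F ≥ 0`, `∫ 1[hc](y) F(v₀(y)) m^{⊗(k+1)}(dy) = (∫ F dM_{β,u}) · m^{⊗(k+1)}{hc}` — split off the first particle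
  (`lintegral_prod_pi_cons`), use the insertion identity `1[hc](p :: x) = 1[hc](x) 1{B(p.1, ε) vacant in superposeIn Λ x Y}`
  (`indicator_hardCore_cons_eq`, valid a.e.), whose right side depends on the new particle only through its POSITION, and
  Tonelli over `m = Leb_Λ ⊗ M_{β,u}` (`lintegral_prod_mul`);
* `gmc_setLIntegral_hardCore_mark_eq` — the same for every label `i` (relabelling invariance of `m^{⊗k}` and of the
  hard-core event, `measurePreserving_piCongrLeft`), and summed over the labels:
  `∫_{hc} Σᵢ F(vᵢ) dm^{⊗k} = k (∫ F dM) m^{⊗k}{hc}` (`gmc_setLIntegral_hardCore_sum_mark`);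
* `gmc_windowSum_superposeIn_eq_sum` — a.s. (thrown points distinct with positions in `Λ`) the marked window sum of
  `superposeIn Λ y Y` is `Σᵢ F(vᵢ)`;
* `gmc_lintegral_windowSum_mark_gibbsWeightMeasure`, `…_gibbsSpecMeasure` — hence `E_W[Σ F] = (∫ F dM) E_W[N_Λ]`
  (both sides equal `(∫ F dM) Σₖ (zᵏ/k!) k m^{⊗k}{hc}`, the count being the case `F = 1`), and the same for `γ_Λ(·|Y)`;
* `gmc_lintegral_windowSum_mark_eq` — and for `κ` by DLR.
-/

noncomputable section

open MeasureTheory ProbabilityTheory Set Filter Topology Function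
open scoped ENNReal

namespace Summit.AtomisticToContinuum.HydrodynamicLimit.Theorems.KiferCompactification

open Literature.MathematicalPhysics.KineticTheory (V3)
open Literature.MathematicalPhysics.KineticTheory.HardSphereDLR (gibbsWeightMeasure gibbsSpecMeasure
  lintegral_gibbsWeightMeasure lintegral_gibbsSpecMeasure lintegral_eq_lintegral_gibbsSpecMeasure
  measurableSet_hardCoreIn_superposeIn_left measurable_superposeIn_left sigmaFinite_maxwellPhaseMeasure
  maxwellPhaseMeasure_eq_prod isProbabilityMeasure_withDensity_maxwellianBeta ae_prod_pi_fst_mem_and_notMem_range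
  indicator_hardCore_cons_eq lintegral_prod_pi_cons measurable_finCons' measurable_ballCount ae_pi_maxwellPhaseMeasure_good
  mem_superposeIn_iff measurable_toENNReal_count)
open Literature.Analysis.FluidPDE (IsHardSphereGibbs HardCoreIn superposeIn maxwellPhaseMeasure windowSum windowSumReal
  particlesIn particlesIn_eq windowSum_one)
open Literature.Analysis.FunctionSpaces (PointConfig maxwellianBeta)

/-! ## Integrating out the velocity of one thrown particle -/

/-- **Integrating out the velocity of the first thrown particle.** For a measurable window `Λ`, `β > 0`, a boundary
condition `Y`, `k = n + 1` thrown particles and a measurable `F ≥ 0` on velocities: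
`∫ 1[hc](y) F((y 0).2) m^{⊗(n+1)}(dy) = (∫ F(v) M_β(v-u) dv) · m^{⊗(n+1)}{hc}`. -/
theorem gmc_lintegral_indicator_hardCore_mul_mark (ε : ℝ) {β : ℝ} (hβ : 0 < β) (u : V3) {Λ : Set V3}
    (hΛ : MeasurableSet Λ) (Y : PointConfig (V3 × V3)) (n : ℕ) {F : V3 → ℝ≥0∞} (hF : Measurable F) :
    ∫⁻ y, {x : Fin (n + 1) → V3 × V3 | HardCoreIn ε Λ (superposeIn Λ x Y)}.indicator 1 y * F ((y 0).2)
        ∂(Measure.pi fun _ : Fin (n + 1) => maxwellPhaseMeasure β u Λ) =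
      (∫⁻ v, F v ∂((volume : Measure V3).withDensity fun v => ENNReal.ofReal (maxwellianBeta β (v - u)))) *
        (Measure.pi fun _ : Fin (n + 1) => maxwellPhaseMeasure β u Λ) {x | HardCoreIn ε Λ (superposeIn Λ x Y)} := by
  haveI := sigmaFinite_maxwellPhaseMeasure β u Λ
  haveI := isProbabilityMeasure_withDensity_maxwellianBeta hβ u
  set m := maxwellPhaseMeasure β u Λ with hm
  set Mv : Measure V3 := (volume : Measure V3).withDensity fun v => ENNReal.ofReal (maxwellianBeta β (v - u)) with hMv
  set Hn : Set (Fin n → V3 × V3) := {x | HardCoreIn ε Λ (superposeIn Λ x Y)} with hHn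
  set Hs : Set (Fin (n + 1) → V3 × V3) := {x | HardCoreIn ε Λ (superposeIn Λ x Y)} with hHs
  have hHnm : MeasurableSet Hn := measurableSet_hardCoreIn_superposeIn_left ε hΛ n Y
  have hHsm : MeasurableSet Hs := measurableSet_hardCoreIn_superposeIn_left ε hΛ (n + 1) Y
  -- the ball-vacancy event in `(position of the new particle, thrown points)`, jointly measurable
  set B : Set (V3 × (Fin n → V3 × V3)) := {r | (superposeIn Λ r.2 Y).count (Metric.ball r.1 ε ×ˢ (univ : Set V3)) = 0}
    with hB
  have hBm : MeasurableSet B := by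
    have h := measurable_ballCount ε ((measurable_superposeIn_left hΛ n Y).comp measurable_snd)
      (measurable_fst : Measurable fun r : V3 × (Fin n → V3 × V3) => r.1) (measurableSet_singleton 0)
    have hBeq : B = (fun r : V3 × (Fin n → V3 × V3) =>
        ((((superposeIn Λ r.2 Y).count (Metric.ball r.1 ε ×ˢ (univ : Set V3)) : ℕ∞) : ℝ≥0∞))) ⁻¹' {0} := by
      ext r
      simp only [hB, mem_setOf_eq, mem_preimage, mem_singleton_iff, ENat.toENNReal_eq_zero]
    rw [hBeq]
    exact h
  -- the kernel `K(q₀, x) = 1[hc](x) 1[B](q₀, x)` and its position integral `Ψ`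
  set K : V3 × (Fin n → V3 × V3) → ℝ≥0∞ := fun r => Hn.indicator 1 r.2 * B.indicator 1 r with hK
  have hKm : Measurable K := ((measurable_one.indicator hHnm).comp measurable_snd).mul (measurable_one.indicator hBm)
  set Ψ : V3 → ℝ≥0∞ := fun q₀ => ∫⁻ x, K (q₀, x) ∂(Measure.pi fun _ : Fin n => m) with hΨ
  have hΨm : Measurable Ψ := hKm.lintegral_prod_right'
  -- the general identity `∫ 1[hc](y) G((y 0).2) dm^{⊗(n+1)} = (∫ Ψ dq₀|_Λ) (∫ G dM)` for every measurable `G`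
  have key : ∀ {G : V3 → ℝ≥0∞}, Measurable G →
      ∫⁻ y, Hs.indicator 1 y * G ((y 0).2) ∂(Measure.pi fun _ : Fin (n + 1) => m) =
        (∫⁻ q₀, Ψ q₀ ∂((volume : Measure V3).restrict Λ)) * ∫⁻ v, G v ∂Mv := by
    intro G hG
    calc ∫⁻ y, Hs.indicator 1 y * G ((y 0).2) ∂(Measure.pi fun _ : Fin (n + 1) => m)
        = ∫⁻ q, Hs.indicator 1 (Fin.cons q.1 q.2) * G q.1.2 ∂(m.prod (Measure.pi fun _ : Fin n => m)) := by
          rw [← lintegral_prod_pi_cons m n (fun y => Hs.indicator 1 y * G ((y 0).2))]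
          simp only [Fin.cons_zero]
      _ = ∫⁻ q, K (q.1.1, q.2) * G q.1.2 ∂(m.prod (Measure.pi fun _ : Fin n => m)) := by
          refine lintegral_congr_ae ((ae_prod_pi_fst_mem_and_notMem_range β u hΛ n).mono fun q hq => ?_)
          dsimp only
          rw [indicator_hardCore_cons_eq ε Λ Y hq.1 hq.2, hK]
          simp only
          congr 2
      _ = ∫⁻ p, (∫⁻ x, K (p.1, x) * G p.2 ∂(Measure.pi fun _ : Fin n => m)) ∂m := by
          rw [lintegral_prod _ ?_]
          exact ((hKm.comp (measurable_fst.fst.prodMk measurable_snd)).mul (hG.comp measurable_fst.snd)).aemeasurable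
      _ = ∫⁻ p, Ψ p.1 * G p.2 ∂m := by
          refine lintegral_congr fun p => ?_
          have hKp : Measurable fun x : Fin n → V3 × V3 => K (p.1, x) := hKm.comp (measurable_const.prodMk measurable_id)
          rw [lintegral_mul_const _ hKp]
      _ = (∫⁻ q₀, Ψ q₀ ∂((volume : Measure V3).restrict Λ)) * ∫⁻ v, G v ∂Mv := by
          rw [hm, maxwellPhaseMeasure_eq_prod β u Λ]
          exact lintegral_prod_mul hΨm.aemeasurable hG.aemeasurable
  -- the case `G = 1` computes the hard-core mass
  have hone : (Measure.pi fun _ : Fin (n + 1) => m) Hs = ∫⁻ q₀, Ψ q₀ ∂((volume : Measure V3).restrict Λ) := by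
    have h := key (G := fun _ => 1) measurable_const
    simp only [mul_one, lintegral_const, measure_univ, lintegral_indicator_one hHsm] at h
    exact h
  rw [key hF, hone, mul_comm]

/-- Relabelling the thrown points does not change the superposition. -/
theorem gmc_superposeIn_piCongrLeft (Λ : Set V3) {k : ℕ} (e : Fin k ≃ Fin k) (y : Fin k → V3 × V3)
    (Y : PointConfig (V3 × V3)) :
    superposeIn Λ (MeasurableEquiv.piCongrLeft (fun _ : Fin k => V3 × V3) e y) Y = superposeIn Λ y Y := by
  have hrange : Set.range (MeasurableEquiv.piCongrLeft (fun _ : Fin k => V3 × V3) e y) = Set.range y := by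
    ext p
    simp only [Set.mem_range]
    constructor
    · rintro ⟨j, rfl⟩
      refine ⟨e.symm j, ?_⟩
      conv_lhs => rw [← Equiv.piCongrLeft_apply_apply (P := fun _ : Fin k => V3 × V3) e y (e.symm j)]
      rw [Equiv.apply_symm_apply]
      rfl
    · rintro ⟨a, rfl⟩
      exact ⟨e a, Equiv.piCongrLeft_apply_apply (P := fun _ : Fin k => V3 × V3) e y a⟩
  ext p
  rw [mem_superposeIn_iff, mem_superposeIn_iff, hrange]

/-- **Integrating out the velocity of ANY thrown particle**: for every label `i`,
`∫_{hc} F((y i).2) m^{⊗(n+1)}(dy) = (∫ F dM_{β,u}) · m^{⊗(n+1)}{hc}` (relabelling invariance of `m^{⊗(n+1)}` and of the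
hard-core event reduces to `i = 0`, `gmc_lintegral_indicator_hardCore_mul_mark`). -/
theorem gmc_setLIntegral_hardCore_mark_eq (ε : ℝ) {β : ℝ} (hβ : 0 < β) (u : V3) {Λ : Set V3}
    (hΛ : MeasurableSet Λ) (Y : PointConfig (V3 × V3)) (n : ℕ) {F : V3 → ℝ≥0∞} (hF : Measurable F) (i : Fin (n + 1)) :
    ∫⁻ y in {x : Fin (n + 1) → V3 × V3 | HardCoreIn ε Λ (superposeIn Λ x Y)}, F ((y i).2)
        ∂(Measure.pi fun _ : Fin (n + 1) => maxwellPhaseMeasure β u Λ) =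
      (∫⁻ v, F v ∂((volume : Measure V3).withDensity fun v => ENNReal.ofReal (maxwellianBeta β (v - u)))) *
        (Measure.pi fun _ : Fin (n + 1) => maxwellPhaseMeasure β u Λ) {x | HardCoreIn ε Λ (superposeIn Λ x Y)} := by
  haveI := sigmaFinite_maxwellPhaseMeasure β u Λ
  set m := maxwellPhaseMeasure β u Λ with hm
  set Hs : Set (Fin (n + 1) → V3 × V3) := {x | HardCoreIn ε Λ (superposeIn Λ x Y)} with hHs
  have hHsm : MeasurableSet Hs := measurableSet_hardCoreIn_superposeIn_left ε hΛ (n + 1) Y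
  set e : Fin (n + 1) ≃ Fin (n + 1) := Equiv.swap 0 i with he
  set T := MeasurableEquiv.piCongrLeft (fun _ : Fin (n + 1) => V3 × V3) e with hT
  have hmp : MeasurePreserving T (Measure.pi fun _ : Fin (n + 1) => m) (Measure.pi fun _ : Fin (n + 1) => m) :=
    measurePreserving_piCongrLeft (fun _ : Fin (n + 1) => m) e
  have hT0 : ∀ y, T y i = y 0 := fun y => by
    have h := Equiv.piCongrLeft_apply_apply (P := fun _ : Fin (n + 1) => V3 × V3) e y 0
    rw [show e 0 = i from Equiv.swap_apply_left 0 i] at h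
    exact h
  have hpre : T ⁻¹' Hs = Hs := by
    ext y
    simp only [mem_preimage, hHs, mem_setOf_eq, hT, gmc_superposeIn_piCongrLeft]
  -- transport along `T`
  have h1 := hmp.setLIntegral_comp_preimage_emb T.measurableEmbedding (fun y : Fin (n + 1) → V3 × V3 => F ((y i).2)) Hs
  rw [hpre] at h1
  simp only [hT0] at h1
  rw [← h1, ← lintegral_indicator hHsm]
  have hind : ∀ y : Fin (n + 1) → V3 × V3, Hs.indicator (fun y => F ((y 0).2)) y = Hs.indicator 1 y * F ((y 0).2) := by
    intro y
    by_cases hy : y ∈ Hs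
    · simp only [indicator_of_mem hy, Pi.one_apply, one_mul]
    · simp only [indicator_of_notMem hy, zero_mul]
  simp_rw [hind]
  exact gmc_lintegral_indicator_hardCore_mul_mark ε hβ u hΛ Y n hF

/-- **Summing over the labels**: `∫_{hc} Σᵢ F((y i).2) m^{⊗k}(dy) = k (∫ F dM_{β,u}) m^{⊗k}{hc}`. -/
theorem gmc_setLIntegral_hardCore_sum_mark (ε : ℝ) {β : ℝ} (hβ : 0 < β) (u : V3) {Λ : Set V3}
    (hΛ : MeasurableSet Λ) (Y : PointConfig (V3 × V3)) (k : ℕ) {F : V3 → ℝ≥0∞} (hF : Measurable F) :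
    ∫⁻ y in {x : Fin k → V3 × V3 | HardCoreIn ε Λ (superposeIn Λ x Y)}, ∑ i, F ((y i).2)
        ∂(Measure.pi fun _ : Fin k => maxwellPhaseMeasure β u Λ) =
      (k : ℝ≥0∞) * (∫⁻ v, F v ∂((volume : Measure V3).withDensity fun v => ENNReal.ofReal (maxwellianBeta β (v - u)))) *
        (Measure.pi fun _ : Fin k => maxwellPhaseMeasure β u Λ) {x | HardCoreIn ε Λ (superposeIn Λ x Y)} := by
  cases k with
  | zero => simp
  | succ n =>
    have hmeas : ∀ i ∈ (Finset.univ : Finset (Fin (n + 1))), Measurable fun y : Fin (n + 1) → V3 × V3 => F ((y i).2) :=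
      fun i _ => hF.comp (measurable_snd.comp (measurable_pi_apply i))
    rw [lintegral_finsetSum _ hmeas]
    simp only [gmc_setLIntegral_hardCore_mark_eq ε hβ u hΛ Y n hF, Finset.sum_const, Finset.card_univ, Fintype.card_fin,
      nsmul_eq_mul, mul_assoc]

/-! ## The marked window sum of a superposition -/

/-- **If the thrown points are distinct with positions in `Λ`, the marked window sum of the superposition is `Σᵢ F(vᵢ)`**
(the particles above `Λ` are exactly the thrown ones). -/
theorem gmc_windowSum_superposeIn_eq_sum (Λ : Set V3) {k : ℕ} {y : Fin k → V3 × V3} (hy : ∀ i, (y i).1 ∈ Λ)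
    (hinj : Function.Injective y) (Y : PointConfig (V3 × V3)) (F : V3 → ℝ≥0∞) :
    windowSum (superposeIn Λ y Y) Λ (fun p => F p.2) = ∑ i, F ((y i).2) := by
  have hset : particlesIn (superposeIn Λ y Y) Λ = Set.range y := by
    ext a
    rw [particlesIn_eq]
    simp only [mem_inter_iff, mem_preimage, Literature.Analysis.FunctionSpaces.PointConfig.coe_eq_carrier,
      PointConfig.mem_carrier, mem_superposeIn_iff]
    constructor
    · rintro ⟨⟨ha, -⟩ | ⟨-, haΛ⟩, haΛ'⟩
      · exact ha
      · exact absurd haΛ' haΛ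
    · rintro ⟨i, rfl⟩
      exact ⟨Or.inl ⟨⟨i, rfl⟩, hy i⟩, hy i⟩
  rw [windowSum, tsum_congr_set_coe (fun p : V3 × V3 => F p.2) hset, tsum_range (fun p : V3 × V3 => F p.2) hinj,
    tsum_fintype]

/-- Sums over the particles in a window are sums over all particles of the window indicator (copy of the elementary
identity of `Literature/Analysis/FluidPDE/RootedLocalState.lean`, which is not in the import closure). -/
theorem gmc_tsum_particlesIn_eq (ω : PointConfig (V3 × V3)) (A : Set V3) (G : V3 × V3 → ℝ≥0∞) :
    ∑' p : particlesIn ω A, G p = ∑' p : (ω : Set (V3 × V3)), {p : V3 × V3 | p.1 ∈ A}.indicator G p := by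
  rw [tsum_subtype (ω : Set (V3 × V3)) ({p : V3 × V3 | p.1 ∈ A}.indicator G), indicator_indicator, particlesIn_eq,
    tsum_subtype]
  rfl

/-- The marked window sum is a measurable function of the configuration (Campbell measurability). -/
theorem gmc_measurable_windowSum {Λ : Set V3} (hΛ : MeasurableSet Λ) {F : V3 → ℝ≥0∞} (hF : Measurable F) :
    Measurable fun X : PointConfig (V3 × V3) => windowSum X Λ (fun p => F p.2) := by
  have h : (fun X : PointConfig (V3 × V3) => windowSum X Λ (fun p => F p.2)) = fun X : PointConfig (V3 × V3) =>
      ∑' p : ((X : PointConfig (V3 × V3)) : Set (V3 × V3)), {p : V3 × V3 | p.1 ∈ Λ}.indicator (fun p => F p.2) p :=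
    funext fun X => gmc_tsum_particlesIn_eq X Λ fun p => F p.2
  rw [h]
  exact Literature.Analysis.FunctionSpaces.PointConfig.measurable_tsum_carrier
    (f := fun q : PointConfig (V3 × V3) × (V3 × V3) => {p : V3 × V3 | p.1 ∈ Λ}.indicator (fun p => F p.2) q.2)
    (((hF.comp measurable_snd).indicator (measurable_fst hΛ)).comp measurable_snd) measurable_id

/-! ## The marked Campbell identity: weight measure, specification, Gibbs state -/

/-- **`E_W[Σ_{q ∈ Λ} F(v)] = (∫ F dM_{β,u}) · E_W[N_Λ]`** for the un-normalised weight measure of the window `Λ` with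
boundary condition `Y` (`z ≥ 0`, `β > 0`): both sides equal `(∫ F dM) Σₖ (zᵏ/k!) k m^{⊗k}{hc}`. -/
theorem gmc_lintegral_windowSum_mark_gibbsWeightMeasure (ε z : ℝ) {β : ℝ} (hβ : 0 < β) (u : V3) {Λ : Set V3}
    (hΛ : MeasurableSet Λ) (Y : PointConfig (V3 × V3)) {F : V3 → ℝ≥0∞} (hF : Measurable F) :
    ∫⁻ X, windowSum X Λ (fun p => F p.2) ∂(gibbsWeightMeasure ε z β u Λ Y) =
      (∫⁻ v, F v ∂((volume : Measure V3).withDensity fun v => ENNReal.ofReal (maxwellianBeta β (v - u)))) *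
        ∫⁻ X, ((X.count (Λ ×ˢ (univ : Set V3)) : ℕ∞) : ℝ≥0∞) ∂(gibbsWeightMeasure ε z β u Λ Y) := by
  haveI := sigmaFinite_maxwellPhaseMeasure β u Λ
  haveI := isProbabilityMeasure_withDensity_maxwellianBeta hβ u
  set Mv : Measure V3 := (volume : Measure V3).withDensity fun v => ENNReal.ofReal (maxwellianBeta β (v - u)) with hMv
  set P : ℕ → ℝ≥0∞ := fun k => (Measure.pi fun _ : Fin k => maxwellPhaseMeasure β u Λ)
    {x | HardCoreIn ε Λ (superposeIn Λ x Y)} with hP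
  -- the general formula
  have key : ∀ {G : V3 → ℝ≥0∞}, Measurable G → ∫⁻ X, windowSum X Λ (fun p => G p.2) ∂(gibbsWeightMeasure ε z β u Λ Y) =
      (∫⁻ v, G v ∂Mv) * ∑' k, ENNReal.ofReal (z ^ k / (Nat.factorial k)) * ((k : ℝ≥0∞) * P k) := by
    intro G hG
    rw [lintegral_gibbsWeightMeasure ε z β u hΛ Y (gmc_measurable_windowSum hΛ hG)]
    have hk : ∀ k : ℕ, ∫⁻ y in {x : Fin k → V3 × V3 | HardCoreIn ε Λ (superposeIn Λ x Y)},
        windowSum (superposeIn Λ y Y) Λ (fun p => G p.2) ∂(Measure.pi fun _ : Fin k => maxwellPhaseMeasure β u Λ) =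
        (k : ℝ≥0∞) * (∫⁻ v, G v ∂Mv) * P k := by
      intro k
      rw [← gmc_setLIntegral_hardCore_sum_mark ε hβ u hΛ Y k hG]
      refine setLIntegral_congr_fun_ae (measurableSet_hardCoreIn_superposeIn_left ε hΛ k Y) ?_
      filter_upwards [ae_pi_maxwellPhaseMeasure_good β u hΛ k] with y hy _
      exact gmc_windowSum_superposeIn_eq_sum Λ hy.1 hy.2 Y G
    rw [tsum_congr fun k => by rw [hk k], ← ENNReal.tsum_mul_left]
    refine tsum_congr fun k => ?_
    ring
  -- the count is the case `G = 1`
  have hcount : ∫⁻ X, ((X.count (Λ ×ˢ (univ : Set V3)) : ℕ∞) : ℝ≥0∞) ∂(gibbsWeightMeasure ε z β u Λ Y) =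
      ∑' k, ENNReal.ofReal (z ^ k / (Nat.factorial k)) * ((k : ℝ≥0∞) * P k) := by
    have h := key (G := fun _ => 1) measurable_const
    simp only [lintegral_const, measure_univ, one_mul] at h
    rw [← h]
    refine lintegral_congr fun X => ?_
    rw [← windowSum_one]
    rfl
  rw [key hF, hcount]

/-- **`E_{γ(·|Y)}[Σ_{q ∈ Λ} F(v)] = (∫ F dM_{β,u}) · E_{γ(·|Y)}[N_Λ]`** for the finite-volume specification. -/
theorem gmc_lintegral_windowSum_mark_gibbsSpecMeasure (ε z : ℝ) {β : ℝ} (hβ : 0 < β) (u : V3) {Λ : Set V3}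
    (hΛ : MeasurableSet Λ) (Y : PointConfig (V3 × V3)) {F : V3 → ℝ≥0∞} (hF : Measurable F) :
    ∫⁻ X, windowSum X Λ (fun p => F p.2) ∂(gibbsSpecMeasure ε z β u Λ Y) =
      (∫⁻ v, F v ∂((volume : Measure V3).withDensity fun v => ENNReal.ofReal (maxwellianBeta β (v - u)))) *
        ∫⁻ X, ((X.count (Λ ×ˢ (univ : Set V3)) : ℕ∞) : ℝ≥0∞) ∂(gibbsSpecMeasure ε z β u Λ Y) := by
  rw [lintegral_gibbsSpecMeasure, lintegral_gibbsSpecMeasure, gmc_lintegral_windowSum_mark_gibbsWeightMeasure ε z hβ u hΛ Y hF]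
  ring

/-- **THE MARKED CAMPBELL IDENTITY OF A HARD-SPHERE GIBBS STATE** (piece (P1) of the Gibbs-mixture wall). For a DLR state
`κ` of the hard-sphere gas of diameter `ε` (`IsHardSphereGibbs ε z β u κ`, any `z`, `β > 0`), a bounded measurable window
`Λ` and a measurable `F ≥ 0` on velocities:
`∫⁻ Σ_{(q,v) ∈ ω, q ∈ Λ} F(v) κ(dω) = (∫⁻ F(v) M_β(v - u) dv) · ∫⁻ N_Λ dκ` — the one-body measure of `κ` above `Λ` is
`(intensity measure) ⊗ Maxwellian(β, u)`; no translation invariance is needed. -/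
theorem gmc_lintegral_windowSum_mark_eq {ε z β : ℝ} {u : V3} {κ : Measure (PointConfig (V3 × V3))}
    (hκ : IsHardSphereGibbs ε z β u κ) (hβ : 0 < β) {Λ : Set V3} (hΛ : MeasurableSet Λ) (hΛb : Bornology.IsBounded Λ)
    {F : V3 → ℝ≥0∞} (hF : Measurable F) :
    ∫⁻ ω, windowSum ω Λ (fun p => F p.2) ∂κ =
      (∫⁻ v, F v ∂((volume : Measure V3).withDensity fun v => ENNReal.ofReal (maxwellianBeta β (v - u)))) *
        ∫⁻ ω, ((ω.count (Λ ×ˢ (univ : Set V3)) : ℕ∞) : ℝ≥0∞) ∂κ := by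
  have hcm := measurable_toENNReal_count ((hΛ.prod MeasurableSet.univ : MeasurableSet (Λ ×ˢ (univ : Set V3))))
  have h2 : Measurable fun Y => ∫⁻ X, ((X.count (Λ ×ˢ (univ : Set V3)) : ℕ∞) : ℝ≥0∞) ∂(gibbsSpecMeasure ε z β u Λ Y) :=
    (Measure.measurable_lintegral hcm).comp
      (Literature.MathematicalPhysics.KineticTheory.HardSphereDLR.measurable_gibbsSpecMeasure ε z β u hΛ)
  rw [lintegral_eq_lintegral_gibbsSpecMeasure hκ hΛ hΛb (gmc_measurable_windowSum hΛ hF).aemeasurable,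
    lintegral_eq_lintegral_gibbsSpecMeasure hκ hΛ hΛb hcm.aemeasurable, ← lintegral_const_mul _ h2]
  exact lintegral_congr fun Y => gmc_lintegral_windowSum_mark_gibbsSpecMeasure ε z hβ u hΛ Y hF

/-! ## Real form: bounded test functions of the velocity -/

/-- With finitely many particles above the window, the `ℝ≥0∞`-valued window sum is a finite sum. -/
theorem gmc_windowSum_eq_sum {ω : PointConfig (V3 × V3)} {Λ : Set V3} (hP : (particlesIn ω Λ).Finite)
    (f : V3 × V3 → ℝ≥0∞) : windowSum ω Λ f = ∑ p ∈ hP.toFinset, f p := by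
  unfold windowSum
  rw [tsum_congr_set_coe f hP.coe_toFinset.symm, tsum_subtype, sum_eq_tsum_indicator]

/-- With finitely many particles above the window, the real window sum is a finite sum. -/
theorem gmc_windowSumReal_eq_sum {ω : PointConfig (V3 × V3)} {Λ : Set V3} (hP : (particlesIn ω Λ).Finite)
    (f : V3 × V3 → ℝ) : windowSumReal ω Λ f = ∑ p ∈ hP.toFinset, f p := by
  unfold windowSumReal
  rw [tsum_congr_set_coe f hP.coe_toFinset.symm, tsum_subtype, sum_eq_tsum_indicator]

/-- **THE MARKED CAMPBELL IDENTITY, REAL FORM.** For a hard-sphere Gibbs state `κ` (`z ≥ 0`, `β > 0`), a bounded measurable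
window `Λ` and a bounded measurable `G` on velocities:
`E_κ[Σ_{(q,v) ∈ ω, q ∈ Λ} G(v)] = E_κ[N_Λ] · ∫ G(v) M_β(v - u) dv` (the mean number of particles above `Λ` is finite,
`≤ z vol Λ`, so a.s. finitely many particles lie above `Λ` and the window functional is integrable). -/
theorem gmc_integral_windowSumReal_mark_eq {ε z β : ℝ} {u : V3} {κ : Measure (PointConfig (V3 × V3))}
    (hκ : IsHardSphereGibbs ε z β u κ) (hz : 0 ≤ z) (hβ : 0 < β) {Λ : Set V3} (hΛ : MeasurableSet Λ)
    (hΛb : Bornology.IsBounded Λ) {G : V3 → ℝ} (hGm : Measurable G) {K : ℝ} (hGK : ∀ v, |G v| ≤ K) :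
    ∫ ω, windowSumReal ω Λ (fun p => G p.2) ∂κ =
      (∫⁻ ω, ((ω.count (Λ ×ˢ (univ : Set V3)) : ℕ∞) : ℝ≥0∞) ∂κ).toReal *
        ∫ v, G v ∂((volume : Measure V3).withDensity fun v => ENNReal.ofReal (maxwellianBeta β (v - u))) := by
  haveI := hκ.1
  haveI := isProbabilityMeasure_withDensity_maxwellianBeta hβ u
  -- the mean count is finite, so a.s. finitely many particles lie above `Λ`
  set Nc : PointConfig (V3 × V3) → ℝ≥0∞ := fun ω => ((ω.count (Λ ×ˢ (univ : Set V3)) : ℕ∞) : ℝ≥0∞) with hNc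
  have hNcm : Measurable Nc := measurable_toENNReal_count (hΛ.prod MeasurableSet.univ)
  have hNfin : ∫⁻ ω, Nc ω ∂κ ≠ ∞ :=
    ((Literature.MathematicalPhysics.KineticTheory.HardSphereDLR.lintegral_count_le_activity_mul_volume hκ hz hβ hΛ
      hΛb).trans_lt (ENNReal.mul_lt_top ENNReal.ofReal_lt_top hΛb.measure_lt_top)).ne
  have hfinite : ∀ᵐ ω ∂κ, (particlesIn ω Λ).Finite := by
    filter_upwards [ae_lt_top hNcm hNfin] with ω hω
    simp only [hNc, ENat.toENNReal_lt_top] at hω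
    have h : (ω.carrier ∩ Λ ×ˢ (univ : Set V3)).encard < ⊤ := hω
    rw [Set.encard_lt_top_iff] at h
    rwa [particlesIn_eq, ← Set.prod_univ]
  -- the `ℝ≥0∞` sums of the positive and negative parts and their means
  have hGpm : Measurable fun v => ENNReal.ofReal (G v) := hGm.ennreal_ofReal
  have hGnm : Measurable fun v => ENNReal.ofReal (-G v) := hGm.neg.ennreal_ofReal
  set Sp : PointConfig (V3 × V3) → ℝ≥0∞ := fun ω => windowSum ω Λ (fun p => ENNReal.ofReal (G p.2)) with hSp
  set Sn : PointConfig (V3 × V3) → ℝ≥0∞ := fun ω => windowSum ω Λ (fun p => ENNReal.ofReal (-G p.2)) with hSn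
  have hSpm : Measurable Sp := gmc_measurable_windowSum hΛ hGpm
  have hSnm : Measurable Sn := gmc_measurable_windowSum hΛ hGnm
  have hIp : ∫⁻ ω, Sp ω ∂κ = _ := gmc_lintegral_windowSum_mark_eq hκ hβ hΛ hΛb hGpm
  have hIn : ∫⁻ ω, Sn ω ∂κ = _ := gmc_lintegral_windowSum_mark_eq hκ hβ hΛ hΛb hGnm
  have hGp_fin : ∫⁻ v, ENNReal.ofReal (G v) ∂((volume : Measure V3).withDensity fun v =>
      ENNReal.ofReal (maxwellianBeta β (v - u))) ≠ ∞ := by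
    refine (lt_of_le_of_lt (lintegral_mono fun v => ENNReal.ofReal_le_ofReal ((le_abs_self _).trans (hGK v))) ?_).ne
    rw [lintegral_const, measure_univ, mul_one]
    exact ENNReal.ofReal_lt_top
  have hGn_fin : ∫⁻ v, ENNReal.ofReal (-G v) ∂((volume : Measure V3).withDensity fun v =>
      ENNReal.ofReal (maxwellianBeta β (v - u))) ≠ ∞ := by
    refine (lt_of_le_of_lt (lintegral_mono fun v => ENNReal.ofReal_le_ofReal ((neg_le_abs _).trans (hGK v))) ?_).ne
    rw [lintegral_const, measure_univ, mul_one]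
    exact ENNReal.ofReal_lt_top
  have hSp_fin : ∫⁻ ω, Sp ω ∂κ ≠ ∞ := by rw [hIp]; exact ENNReal.mul_ne_top hGp_fin hNfin
  have hSn_fin : ∫⁻ ω, Sn ω ∂κ ≠ ∞ := by rw [hIn]; exact ENNReal.mul_ne_top hGn_fin hNfin
  -- a.s. the real window sum is the difference of the two
  have hae : ∀ᵐ ω ∂κ, windowSumReal ω Λ (fun p => G p.2) = (Sp ω).toReal - (Sn ω).toReal := by
    filter_upwards [hfinite] with ω hω
    rw [gmc_windowSumReal_eq_sum hω, hSp, hSn]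
    dsimp only
    rw [gmc_windowSum_eq_sum hω, gmc_windowSum_eq_sum hω, ENNReal.toReal_sum fun p _ => ENNReal.ofReal_ne_top,
      ENNReal.toReal_sum fun p _ => ENNReal.ofReal_ne_top, ← Finset.sum_sub_distrib]
    refine Finset.sum_congr rfl fun p _ => ?_
    rw [ENNReal.toReal_ofReal', ENNReal.toReal_ofReal']
    exact (max_zero_sub_max_neg_zero_eq_self (G p.2)).symm
  -- integrate
  have hGi : Integrable G ((volume : Measure V3).withDensity fun v => ENNReal.ofReal (maxwellianBeta β (v - u))) :=
    Integrable.of_bound hGm.aestronglyMeasurable K (ae_of_all _ fun v => by rw [Real.norm_eq_abs]; exact hGK v)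
  rw [integral_congr_ae hae, integral_sub (integrable_toReal_of_lintegral_ne_top hSpm.aemeasurable hSp_fin)
    (integrable_toReal_of_lintegral_ne_top hSnm.aemeasurable hSn_fin), integral_toReal hSpm.aemeasurable
    (ae_lt_top hSpm hSp_fin), integral_toReal hSnm.aemeasurable (ae_lt_top hSnm hSn_fin),
    integral_eq_lintegral_pos_part_sub_lintegral_neg_part hGi, hIp, hIn, ENNReal.toReal_mul, ENNReal.toReal_mul]
  ring

end Summit.AtomisticToContinuum.HydrodynamicLimit.Theorems.KiferCompactification

end
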